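import Summits.ABC.StewartYu.PadicG3TwoSlabSeries
import Summits.ABC.StewartYu.PadicG3TwoKChain
import HarnessLib

/-!
# Cell abc-stewartyu, Gen-3 frame at `p = 2` (crux `Y07Two`, stmt-ABC-19659), layer F4b/F4c-SLAB: the `2`-adic
# extrapolation step ON THE SLAB — gain `(4·2^m)` per zero at the integer nodes — and the inner chain

`Summits/ABC/StewartYu/PadicG3TwoSlabKStep.lean` — cell `abc-stewartyu` (HOME `run/shared/lean/pub/abc-stewartyu/`),
route `PadicPrimesKummerThird`, seat p3 (g5), F-two LEAD (design of record D-F2).  Theorems on `TwoSetup`; twin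
of `PadicG3TwoKStep.lean`/`PadicG3TwoKChain.lean` (the case `m = 0`) for the slab family `G_τ`
(`PadicG3TwoSlabFunctions`, `PadicG3TwoSlabSeries`).

* **`norm_g3G_le_of_zeros`** — if the rational values `g3φ τ'' x` vanish for `|x| ≤ N`, `|τ''| < Tlo`, the
  unknowns lie on a slab (`‖zexpo i − zexpo i₀‖ ≤ 2^{−(m+3)}` on `B`) and the `Y₀`-weights satisfy
  `‖coeffₖ(hw i t₀)‖·(4·2^m)ᵏ ≤ Bw`, then for `‖z‖ ≤ 1`, `|τ| + t ≤ Tlo`: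
  `‖G_τ(z)‖, ‖φ_τ(z)‖ ≤ max (Bw·‖Λ₀‖·2ᵗ·2^{condExp 2 (2N+1) t}) (Bw / (4·2^m)^{(2N+1)·t})` — the small-jets
  Schwarz lemma with levels at radius `ρ = 4·2^m` (`r = 1`), i.e. the gain `(m+2)·log 2` PER ZERO that the
  `cⁿ` ledger needs (θ₀(2) = 2), with the same `2`-adic conditioning as the slab-less step;
* **`g3_slab_kstep`**, **`g3_slab_kchain`** — + Liouville (`PadicG3TwoValues.g3φ_eq_zero_of_norm_lt`) ⇒ vanishing
  at the new points, and the chain along a range schedule (Yu 2013 Lemma 5.2).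

WHAT THIS IS NOT: no choice of `m`, `N`, `Tlo`, `t`, `Bw`, `K` (record); no Kummer descent (F5); no crux moves.

References: K. Yu, Acta Arith. 89 (1999) §2; K. Yu, Acta Math. 211 (2013), Lemma 5.2, (5.23)–(5.31);
K. Yu, Compositio Math. 74 (1990), Lemma 1.2, §3.
-/

noncomputable section

open NormedSpace Finset IsUltrametricDist Polynomial Metric Filter
open Literature.NumberTheory.Transcendental
open Literature.NumberTheory.Transcendental.PadicCW77 (nodeSeq length_nodeSeq mem_nodeSeq count_nodeSeq
  countP_nodeSeq card_filter_range_mod_le condExp)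
open scoped Nat Topology

namespace Summit.ABC.StewartYu

open Literature.NumberTheory.Transcendental.CW77.Setup (Tau tauNorm)

namespace TwoSetup

variable (S : TwoSetup) {ι : Type*} (R : ι → ℚ[X]) (u : ι → Fin S.d → ℤ) (uθ : ι → ℤ)

/-! ### The `Y₀`-weights on the unit disc (any weight radius `ρ ≥ 1`) -/

/-- On `‖z‖ ≤ 1`, `‖(hw i t₀)(z)‖ ≤ Bw` if `‖coeffₖ(hw i t₀)‖·ρᵏ ≤ Bw` for all `k` and `1 ≤ ρ`. [folklore] -/
theorem norm_hw_eval_le_of_wt' (i : ι) (t₀ : ℕ) {ρ Bw : ℝ} (hρ1 : 1 ≤ ρ) (hBw0 : 0 ≤ Bw)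
    (hBw : ∀ k, ‖(hw R i t₀).coeff k‖ * ρ ^ k ≤ Bw) {z : ℚ_[2]} (hz : ‖z‖ ≤ 1) :
    ‖(hw R i t₀).eval z‖ ≤ Bw := by
  rw [hw_eval_eq_sum]
  refine norm_sum_le_of_forall_le_of_nonneg hBw0 fun k _ => ?_
  unfold g3wC
  rw [norm_mul, norm_pow]
  have h4 : (1 : ℝ) ≤ ρ ^ k := one_le_pow₀ hρ1
  calc ‖(hw R i t₀).coeff k‖ * ‖z‖ ^ k ≤ ‖(hw R i t₀).coeff k‖ * 1 :=
        mul_le_mul_of_nonneg_left (pow_le_one₀ (norm_nonneg _) hz) (norm_nonneg _)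
    _ ≤ ‖(hw R i t₀).coeff k‖ * ρ ^ k := mul_le_mul_of_nonneg_left h4 (norm_nonneg _)
    _ ≤ Bw := hBw k

/-! ### The extrapolation bound on the slab -/

/-- **The `2`-adic extrapolation bound ON THE SLAB** (gain `(4·2^m)` per zero).  See the module docstring.
[cite: Yu1999, §2] [cite: Yu2013, Lemma 5.2] [cite: Yu1990, Lemma 1.2] -/
theorem norm_g3G_le_of_zeros (B : Finset ι) (p : ι → ℤ) (i₀ : ι) {m : ℕ}
    (hslab : ∀ i ∈ B, ‖S.δexpo u uθ i₀ i‖ ≤ ((2 : ℝ) ^ (m + 3))⁻¹) {N Tlo t : ℕ} (ht : 1 ≤ t)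
    {Bw : ℝ} (hBw0 : 0 ≤ Bw) (hBw : ∀ i ∈ B, ∀ t₀ k, ‖(hw R i t₀).coeff k‖ * (4 * (2 : ℝ) ^ m) ^ k ≤ Bw)
    (hzero : ∀ x : ℤ, |x| ≤ (N : ℤ) → ∀ τ'' : Tau S.d, tauNorm τ'' < Tlo →
      S.g3φ R u uθ B p τ'' x = 0)
    {z : ℚ_[2]} (hz : ‖z‖ ≤ 1) (τ : Tau S.d) (hτ : tauNorm τ + t ≤ Tlo) :
    ‖S.g3G R u uθ B p i₀ τ z‖ ≤
        max (Bw * ‖S.Λ₀‖ * (2 : ℝ) ^ t * (2 : ℝ) ^ condExp 2 (2 * N + 1) t)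
          (Bw / (4 * (2 : ℝ) ^ m) ^ ((2 * N + 1) * t)) ∧
      ‖S.g3Φ R u uθ B p τ z‖ ≤
        max (Bw * ‖S.Λ₀‖ * (2 : ℝ) ^ t * (2 : ℝ) ^ condExp 2 (2 * N + 1) t)
          (Bw / (4 * (2 : ℝ) ^ m) ^ ((2 * N + 1) * t)) := by
  classical
  have hTlo : 1 ≤ Tlo := by omega
  set kpts : ℕ := 2 * N + 1 with hkpts
  set Pt : ℝ := (2 : ℝ) ^ (t - 1) with hPt
  set ρ : ℝ := 4 * (2 : ℝ) ^ m with hρdef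
  have h2m : (1 : ℝ) ≤ (2 : ℝ) ^ m := one_le_pow₀ (by norm_num)
  have hρ : 0 < ρ := by positivity
  have h1ρ : (1 : ℝ) < ρ := by rw [hρdef]; nlinarith
  have hρ1 : (1 : ℝ) ≤ ρ := h1ρ.le
  have hΛ0 : 0 ≤ ‖S.Λ₀‖ := norm_nonneg _
  -- (a) the `f − φ` comparison on the unit disc with `Q := Bw`
  have hz2 : ∀ z : ℚ_[2], ‖z‖ ≤ 1 → ‖z‖ ≤ 2 := fun z hz => hz.trans (by norm_num)
  have hQ : ∀ (τ' : Tau S.d) (z : ℚ_[2]), ‖z‖ ≤ 1 → ∀ i ∈ B, ‖(hw R i τ'.1).eval z‖ ≤ Bw :=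
    fun τ' z hz i hi => norm_hw_eval_le_of_wt' R i τ'.1 hρ1 hBw0 (hBw i hi τ'.1) hz
  have hFΦ : ∀ (τ' : Tau S.d) (z : ℚ_[2]), ‖z‖ ≤ 1 →
      ‖S.g3F R u uθ B p τ' z - S.g3Φ R u uθ B p τ' z‖ ≤ Bw * (2 * ‖S.Λ₀‖) := fun τ' z hz =>
    S.norm_g3F_sub_g3Φ_le R u uθ B p τ' (hz2 z hz) hBw0 (hQ τ' z hz)
  -- integers lie in the unit disc
  have hint : ∀ x : ℤ, ‖(x : ℚ_[2])‖ ≤ 1 := fun x => Padic.norm_int_le_one (p := 2) x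
  -- the nodes `node i = i − N`, `i < 2N+1`
  set node : ℕ → ℚ_[2] := fun i => (((i : ℤ) - N : ℤ) : ℚ_[2]) with hnode
  have hnodeZ : ∀ i < kpts, |((i : ℤ) - N)| ≤ (N : ℤ) := by
    intro i hi; rw [abs_le]; constructor <;> omega
  -- (b) values of `G` at the nodes: `‖G(x)‖ = ‖f(x)‖ = ‖f(x) − φ(x)‖`
  have hval : ∀ i < kpts, ∀ τ' : Tau S.d, tauNorm τ' ≤ Tlo - 1 →
      ‖S.g3G R u uθ B p i₀ τ' (node i)‖ ≤ Bw * (2 * ‖S.Λ₀‖) := by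
    intro i hi τ' hτ'
    have h0 : S.g3Φ R u uθ B p τ' (node i) = 0 := by
      simp only [hnode]
      rw [S.g3Φ_intCast, hzero _ (hnodeZ i hi) τ' (by omega), Rat.cast_zero]
    have h1 := hFΦ τ' (node i) (by simp only [hnode]; exact hint _)
    rw [h0, sub_zero] at h1
    simp only [hnode] at h1 ⊢
    rw [S.norm_g3G_intCast R u uθ B p i₀ hslab τ']
    exact h1
  -- the coefficient sequence and its weighted bound
  set b : ℕ → ℚ_[2] := S.coeffG3G R u uθ B p i₀ τ with hb
  have hbB : PadicNewton.WtBdd ρ Bw b :=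
    S.wtBdd_coeffG3G R u uθ B p i₀ hslab τ hBw0 (fun i hi k => hBw i hi τ.1 k)
  -- the node set
  set nodes : Finset ℚ_[2] := (range kpts).image node with hnodes
  have hmem : ∀ a ∈ nodes, ∃ i < kpts, a = node i := by
    intro a ha
    obtain ⟨i, hi, rfl⟩ := mem_image.mp ha
    exact ⟨i, mem_range.mp hi, rfl⟩
  have hnod : ∀ a ∈ nodes, ‖a‖ ≤ 1 := by
    intro a ha; obtain ⟨i, -, rfl⟩ := hmem a ha; simp only [hnode]; exact hint _
  have hdiff : ∀ i i' : ℕ, node i - node i' = (((i : ℤ) - i' : ℤ) : ℚ_[2]) := by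
    intro i i'; simp only [hnode]; push_cast; ring
  -- the level structure
  set R0 : ℕ → ℝ := fun j => ((2 : ℝ)⁻¹) ^ j with hR0def
  have hR0pos : ∀ j, 0 < R0 j := fun j => by simp only [hR0def]; positivity
  have hR0anti : ∀ a b, a ≤ b → R0 b ≤ R0 a := fun a b hab => by
    simp only [hR0def]
    exact pow_le_pow_of_le_one (by positivity) (by norm_num) hab
  have hR0ratio : ∀ j, R0 j / R0 (j + 1) = 2 := by
    intro j; simp only [hR0def, pow_succ]; field_simp
  have hR0zpow : ∀ j : ℕ, R0 j = ((2 : ℕ) : ℝ) ^ (-(j : ℤ)) := fun j => by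
    simp only [hR0def, zpow_neg, zpow_natCast, inv_pow]; norm_num
  set Jm : ℕ := Nat.log 2 kpts with hJm
  set Rl : ℕ → ℝ := fun j => R0 (min j Jm) with hRl
  have hRl0 : Rl 0 = 1 := by simp [hRl, hR0def]
  have hRlpos : ∀ j, 0 < Rl j := fun j => hR0pos _
  have hRlanti : ∀ j, Rl (j + 1) ≤ Rl j := fun j =>
    hR0anti _ _ (min_le_min (Nat.le_succ j) le_rfl)
  have hlev : ∀ a ∈ nodes, ∀ a' ∈ nodes, a ≠ a' → ∃ j < Jm + 1, ‖a - a'‖ = Rl j := by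
    intro a ha a' ha' hne
    obtain ⟨i, hi, rfl⟩ := hmem a ha
    obtain ⟨i', hi', rfl⟩ := hmem a' ha'
    set mm : ℤ := (i : ℤ) - i' with hmm
    have hm0 : mm ≠ 0 := by
      intro h0; apply hne
      have : (i : ℤ) = i' := by omega
      have : i = i' := by exact_mod_cast this
      simp only [hnode, this]
    have hmabs : mm.natAbs ≤ kpts := by omega
    have hdvd : 2 ^ padicValInt 2 mm ∣ mm.natAbs := by
      have h1 := Int.natAbs_dvd_natAbs.mpr (padicValInt_dvd (p := 2) mm)
      simpa [Int.natAbs_pow] using h1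
    have hvle : padicValInt 2 mm ≤ Jm := by
      have h2 : 2 ^ padicValInt 2 mm ≤ kpts :=
        (Nat.le_of_dvd (Int.natAbs_pos.mpr hm0) hdvd).trans hmabs
      exact Nat.le_log_of_pow_le (by norm_num) h2
    refine ⟨padicValInt 2 mm, by omega, ?_⟩
    have hRv : Rl (padicValInt 2 mm) = R0 (padicValInt 2 mm) := by
      simp only [hRl, min_eq_left hvle]
    rw [hRv, hdiff, hR0zpow]
    have : ((mm : ℚ) : ℚ_[2]) = (mm : ℚ_[2]) := by push_cast; rfl
    rw [← this, Padic.norm_eq_zpow_neg_valuation (by exact_mod_cast hm0), Padic.valuation_ratCast,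
      padicValRat.of_int]
  -- (c) the jets at the nodes
  set εj : ℝ := Bw * (2 * ‖S.Λ₀‖) * Pt with hεj
  have hεj0 : 0 ≤ εj := by positivity
  have hjet : ∀ a ∈ nodes, ∀ k < t, ‖∑' n, PadicNewton.ddList (List.replicate k a) b n * a ^ n‖ ≤ εj := by
    intro a ha k hkt
    obtain ⟨i, hi, rfl⟩ := hmem a ha
    have hj := S.norm_jet_g3G_le R u uθ B p i₀ hslab hBw0 (hz2 _ (by simp only [hnode]; exact hint _))
      (Tlo - 1) (by positivity) (fun τ' hτ' => hval i hi τ' hτ') k τ (fun i' hi' k' => hBw i' hi' τ.1 k')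
      (by omega)
    change ‖PadicNewton.jet _ b k‖ ≤ εj
    refine hj.trans ?_
    rw [hεj, mul_comm]
    refine mul_le_mul_of_nonneg_left ?_ (by positivity)
    exact (norm_inv_factorial_le_two_pow k).trans (pow_le_pow_right₀ (by norm_num) (by omega))
  -- the node sequence
  have hcast_inj : Function.Injective node := by
    intro i i' hii'
    simp only [hnode] at hii'
    have h' : ((i : ℤ) - N : ℤ) = (i' : ℤ) - N := by exact_mod_cast (Int.cast_injective (α := ℚ_[2]) hii')
    have : (i : ℤ) = i' := by omega
    exact_mod_cast this
  set xs : List ℚ_[2] := nodeSeq node kpts t with hxs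
  have hxs_mem : ∀ x ∈ xs, x ∈ nodes := by
    intro x hx
    obtain ⟨i, hi, rfl⟩ := mem_nodeSeq hx
    exact mem_image.mpr ⟨i, by simpa using hi, rfl⟩
  have hxs_len : xs.length = kpts * t := length_nodeSeq node kpts t
  have hxs_cnt : ∀ a ∈ nodes, xs.count a ≤ t := by
    intro a ha
    obtain ⟨i, hi, rfl⟩ := hmem a ha
    rw [hxs, count_nodeSeq hcast_inj t kpts i, if_pos hi]
  -- (c') the conditioning
  have hball : ∀ j : ℕ, 1 ≤ j → PadicNewton.ballCount nodes (R0 j) xs ≤ t * (kpts / 2 ^ j + 1) := by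
    intro j hj
    unfold PadicNewton.ballCount
    refine Finset.sup_le fun a ha => ?_
    obtain ⟨i₀', hi₀', rfl⟩ := hmem a ha
    rw [hxs, countP_nodeSeq]
    have hsub : ∀ i ∈ range kpts, decide (‖node i - node i₀'‖ ≤ R0 j) = true →
        i % 2 ^ j = i₀' % 2 ^ j := by
      intro i _ hdec
      have hle : ‖node i - node i₀'‖ ≤ R0 j := of_decide_eq_true hdec
      rw [hdiff, hR0zpow, Padic.norm_int_le_pow_iff_dvd] at hle
      have hmod : i₀' ≡ i [MOD 2 ^ j] := Nat.modEq_iff_dvd.mpr (by push_cast; exact hle)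
      exact hmod.symm
    calc ∑ i ∈ range kpts, (if decide (‖node i - node i₀'‖ ≤ R0 j) = true then t else 0)
        ≤ ∑ i ∈ range kpts, (if i % 2 ^ j = i₀' % 2 ^ j then t else 0) := by
          refine sum_le_sum fun i hi => ?_
          by_cases hd : decide (‖node i - node i₀'‖ ≤ R0 j) = true
          · rw [if_pos hd, if_pos (hsub i hi hd)]
          · rw [if_neg hd]; positivity
      _ = t * ((range kpts).filter fun i => i % 2 ^ j = i₀' % 2 ^ j).card := by
          rw [← Finset.sum_filter]; simp [mul_comm]
      _ ≤ t * (kpts / 2 ^ j + 1) := Nat.mul_le_mul_left _ (card_filter_range_mod_le kpts _ _)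
  have hcond : ∏ j ∈ range (Jm + 1), (Rl j / Rl (j + 1)) ^ PadicNewton.ballCount nodes (Rl (j + 1)) xs ≤
      (2 : ℝ) ^ condExp 2 kpts t := by
    rw [Finset.prod_range_succ]
    have hlast : Rl Jm / Rl (Jm + 1) = 1 := by
      simp only [hRl, min_eq_left (le_refl Jm), min_eq_right (Nat.le_succ Jm), div_self (hR0pos _).ne']
    rw [hlast, one_pow, mul_one]
    have hin : ∀ j ∈ range Jm, (Rl j / Rl (j + 1)) ^ PadicNewton.ballCount nodes (Rl (j + 1)) xs =
        (2 : ℝ) ^ PadicNewton.ballCount nodes (R0 (j + 1)) xs := by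
      intro j hj
      have hj' : j + 1 ≤ Jm := mem_range.mp hj
      simp only [hRl, min_eq_left (Nat.le_of_succ_le hj'), min_eq_left hj', hR0ratio]
    rw [Finset.prod_congr rfl hin, Finset.prod_pow_eq_pow_sum]
    refine pow_le_pow_right₀ (by norm_num) ?_
    have hJm' : Jm ≤ Nat.log 2 (2 * kpts) := Nat.log_mono_right (by omega)
    unfold condExp
    calc ∑ j ∈ range Jm, PadicNewton.ballCount nodes (R0 (j + 1)) xs
        ≤ ∑ j ∈ range Jm, t * (kpts / 2 ^ (j + 1) + 1) := sum_le_sum fun j _ => hball (j + 1) (by omega)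
      _ ≤ ∑ j ∈ range (Nat.log 2 (2 * kpts)), t * (kpts / 2 ^ (j + 1) + 1) :=
          sum_le_sum_of_subset_of_nonneg
            (fun j hj => mem_range.mpr (lt_of_lt_of_le (mem_range.mp hj) hJm')) fun _ _ _ => Nat.zero_le _
  -- (d) the small-jets Schwarz lemma at radius `ρ = 4·2^m`, `r = 1`
  have hschwarz := PadicNewton.norm_tsum_le_max_of_small_jets_levels hρ h1ρ le_rfl hbB nodes hnod
    Rl hRl0 hRlpos hRlanti (Jm + 1) hlev hεj0 hjet xs hxs_mem hxs_cnt hz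
  have hzlt : ‖z‖ < 4 * (2 : ℝ) ^ m := lt_of_le_of_lt hz h1ρ
  have hF : ‖S.g3G R u uθ B p i₀ τ z‖ ≤
      max (εj * ∏ j ∈ range (Jm + 1), (Rl j / Rl (j + 1)) ^ PadicNewton.ballCount nodes (Rl (j + 1)) xs)
        (Bw / ρ ^ xs.length * (xs.map fun x => ‖z - x‖).prod) := by
    rw [S.g3G_eq_tsum R u uθ B p i₀ hslab τ hzlt]; exact hschwarz
  have hprod : (xs.map fun x => ‖z - x‖).prod ≤ 1 := by
    have h := List.prod_map_le_prod_map₀ (s := xs) (fun x => ‖z - x‖)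
      (fun _ => (1 : ℝ)) (fun x _ => norm_nonneg _) (fun x hx => by
        rw [sub_eq_add_neg]
        exact (norm_add_le_max _ _).trans (max_le hz (by rw [norm_neg]; exact hnod x (hxs_mem x hx))))
    simpa using h
  have hPt2 : (2 : ℝ) * Pt = (2 : ℝ) ^ t := by
    rw [hPt, ← pow_succ', Nat.sub_add_cancel ht]
  have hterm1 : εj * ∏ j ∈ range (Jm + 1), (Rl j / Rl (j + 1)) ^ PadicNewton.ballCount nodes (Rl (j + 1)) xs ≤
      Bw * ‖S.Λ₀‖ * (2 : ℝ) ^ t * (2 : ℝ) ^ condExp 2 kpts t := by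
    have e : εj = Bw * ‖S.Λ₀‖ * (2 : ℝ) ^ t := by rw [hεj, ← hPt2]; ring
    rw [e]
    exact mul_le_mul_of_nonneg_left hcond (by positivity)
  have hterm2 : Bw / ρ ^ xs.length * (xs.map fun x => ‖z - x‖).prod ≤ Bw / ρ ^ (kpts * t) := by
    rw [hxs_len]
    exact mul_le_of_le_one_right (by positivity) hprod
  have hG' : ‖S.g3G R u uθ B p i₀ τ z‖ ≤
      max (Bw * ‖S.Λ₀‖ * (2 : ℝ) ^ t * (2 : ℝ) ^ condExp 2 kpts t) (Bw / ρ ^ (kpts * t)) :=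
    hF.trans (max_le_max hterm1 hterm2)
  refine ⟨hG', ?_⟩
  -- `‖φ‖ ≤ max(‖f‖, ‖f − φ‖)` and `‖f(z)‖ = ‖G(z)‖` on `‖z‖ ≤ 1`
  have hz4 : ‖z‖ < 4 := lt_of_le_of_lt hz (by norm_num)
  have hFG : ‖S.g3F R u uθ B p τ z‖ = ‖S.g3G R u uθ B p i₀ τ z‖ := by
    rw [S.g3F_eq_exp_mul_g3G R u uθ B p i₀ hslab τ hz4, norm_mul,
      norm_exp_mul_eq_one (S.norm_zexpo_le _ _) (hz2 z hz), one_mul]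
  have e : S.g3Φ R u uθ B p τ z = S.g3F R u uθ B p τ z + -(S.g3F R u uθ B p τ z - S.g3Φ R u uθ B p τ z) := by
    ring
  rw [e]
  refine (norm_add_le_max _ _).trans (max_le (hFG ▸ hG') ?_)
  rw [norm_neg]
  refine (hFΦ τ _ hz).trans (le_max_of_le_left ?_)
  have h1 : (2 : ℝ) ≤ (2 : ℝ) ^ t := by
    calc (2 : ℝ) = 2 ^ 1 := (pow_one _).symm
      _ ≤ 2 ^ t := pow_le_pow_right₀ (by norm_num) ht
  have h2 : (1 : ℝ) ≤ (2 : ℝ) ^ condExp 2 kpts t := one_le_pow₀ (by norm_num)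
  calc Bw * (2 * ‖S.Λ₀‖) = Bw * ‖S.Λ₀‖ * 2 * 1 := by ring
    _ ≤ Bw * ‖S.Λ₀‖ * (2 : ℝ) ^ t * (2 : ℝ) ^ condExp 2 kpts t := by gcongr

/-! ### The slab k-step and the inner chain -/

/-- **The `2`-adic k-step ON THE SLAB** (twin of `g3_kstep` with the gain `(4·2^m)^{(2N+1)t}`).
[cite: Yu2013, Lemma 5.2] [cite: Yu1999, §2] -/
theorem g3_slab_kstep (B : Finset ι) (p : ι → ℤ) (i₀ : ι) {m : ℕ}
    (hslab : ∀ i ∈ B, ‖S.δexpo u uθ i₀ i‖ ≤ ((2 : ℝ) ^ (m + 3))⁻¹) {N N' Tlo t : ℕ} (ht : 1 ≤ t)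
    {Bw : ℝ} (hBw0 : 0 ≤ Bw) (hBw : ∀ i ∈ B, ∀ t₀ k, ‖(hw R i t₀).coeff k‖ * (4 * (2 : ℝ) ^ m) ^ k ≤ Bw)
    (hzero : ∀ x : ℤ, |x| ≤ (N : ℤ) → ∀ τ'' : Tau S.d, tauNorm τ'' < Tlo →
      S.g3φ R u uθ B p τ'' x = 0)
    {Dbox : Fin S.d → ℕ} {Dθ : ℕ} (hu : ∀ i ∈ B, ∀ j, |u i j| ≤ (Dbox j : ℤ))
    (huθ : ∀ i ∈ B, |uθ i| ≤ (Dθ : ℤ))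
    (den₀ : ℤ → Tau S.d → ℕ) (hden₀ : ∀ x τ, 1 ≤ den₀ x τ) {M₀ : ℤ}
    (hR : ∀ (x : ℤ) (τ : Tau S.d), ∀ i ∈ B,
      ∃ z₀ : ℤ, (den₀ x τ : ℚ) * (hasseDeriv τ.1 (R i)).eval (x : ℚ) = z₀ ∧ |z₀| ≤ M₀)
    {Xb : ℤ} (hX : ∀ i ∈ B, ∀ j, |S.dirScalar (u i) (uθ i) j| ≤ Xb) {P : ℤ} (hP : ∀ i ∈ B, |p i| ≤ P)
    (K : ℤ → Tau S.d → ℝ) (hK0 : ∀ x τ, 0 < K x τ)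
    (hK : ∀ (x : ℤ) (τ : Tau S.d), (B.card : ℝ) * P * (M₀ * (Xb : ℝ) ^ (∑ j, τ.2 j) *
      ((MonomialDen.monDen S.toQ.all (S.boxExp Dbox Dθ x) : ℝ)) ^ 2) ≤ K x τ)
    (hfinal : ∀ x₁ : ℤ, |x₁| ≤ (N' : ℤ) → ∀ τ : Tau S.d, tauNorm τ + t ≤ Tlo →
      max (Bw * ‖S.Λ₀‖ * (2 : ℝ) ^ t * (2 : ℝ) ^ condExp 2 (2 * N + 1) t)
        (Bw / (4 * (2 : ℝ) ^ m) ^ ((2 * N + 1) * t)) < 1 / K x₁ τ) :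
    ∀ x₁ : ℤ, |x₁| ≤ (N' : ℤ) → ∀ τ : Tau S.d, tauNorm τ + t ≤ Tlo →
      S.g3φ R u uθ B p τ x₁ = 0 := by
  intro x₁ hx₁ τ hτ
  have hz : ‖((x₁ : ℤ) : ℚ_[2])‖ ≤ 1 := Padic.norm_int_le_one (p := 2) x₁
  have hcore := (S.norm_g3G_le_of_zeros R u uθ B p i₀ hslab ht hBw0 hBw hzero hz τ hτ).2
  rw [S.g3Φ_intCast] at hcore
  exact S.g3φ_eq_zero_of_norm_lt R u uθ B p hu huθ τ x₁ (hden₀ x₁ τ) (hR x₁ τ) hX hP (hK x₁ τ)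
    (hK0 x₁ τ) (lt_of_le_of_lt hcore (hfinal x₁ hx₁ τ hτ))

/-- **The inner chain ON THE SLAB** (twin of `g3_kchain`; Yu 2013 Lemma 5.2 with the θ₀-gain).
[cite: Yu2013, Lemma 5.2] -/
theorem g3_slab_kchain (B : Finset ι) (p : ι → ℤ) (i₀ : ι) {m : ℕ}
    (hslab : ∀ i ∈ B, ‖S.δexpo u uθ i₀ i‖ ≤ ((2 : ℝ) ^ (m + 3))⁻¹) {T t : ℕ} (ht : 1 ≤ t)
    (Nsched : ℕ → ℕ)
    {Bw : ℝ} (hBw0 : 0 ≤ Bw) (hBw : ∀ i ∈ B, ∀ t₀ k, ‖(hw R i t₀).coeff k‖ * (4 * (2 : ℝ) ^ m) ^ k ≤ Bw)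
    (hzero0 : ∀ x : ℤ, |x| ≤ (Nsched 0 : ℤ) → ∀ τ : Tau S.d, tauNorm τ < T →
      S.g3φ R u uθ B p τ x = 0)
    {Dbox : Fin S.d → ℕ} {Dθ : ℕ} (hu : ∀ i ∈ B, ∀ j, |u i j| ≤ (Dbox j : ℤ))
    (huθ : ∀ i ∈ B, |uθ i| ≤ (Dθ : ℤ))
    (den₀ : ℤ → Tau S.d → ℕ) (hden₀ : ∀ x τ, 1 ≤ den₀ x τ) {M₀ : ℤ}
    (hR : ∀ (x : ℤ) (τ : Tau S.d), ∀ i ∈ B,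
      ∃ z₀ : ℤ, (den₀ x τ : ℚ) * (hasseDeriv τ.1 (R i)).eval (x : ℚ) = z₀ ∧ |z₀| ≤ M₀)
    {Xb : ℤ} (hX : ∀ i ∈ B, ∀ j, |S.dirScalar (u i) (uθ i) j| ≤ Xb) {P : ℤ} (hP : ∀ i ∈ B, |p i| ≤ P)
    (K : ℤ → Tau S.d → ℝ) (hK0 : ∀ x τ, 0 < K x τ)
    (hK : ∀ (x : ℤ) (τ : Tau S.d), (B.card : ℝ) * P * (M₀ * (Xb : ℝ) ^ (∑ j, τ.2 j) *
      ((MonomialDen.monDen S.toQ.all (S.boxExp Dbox Dθ x) : ℝ)) ^ 2) ≤ K x τ)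
    (hfinal : ∀ k, ∀ x₁ : ℤ, |x₁| ≤ (Nsched (k + 1) : ℤ) → ∀ τ : Tau S.d, tauNorm τ + t ≤ T - k * t →
      max (Bw * ‖S.Λ₀‖ * (2 : ℝ) ^ t * (2 : ℝ) ^ condExp 2 (2 * Nsched k + 1) t)
        (Bw / (4 * (2 : ℝ) ^ m) ^ ((2 * Nsched k + 1) * t)) < 1 / K x₁ τ) :
    ∀ k, ∀ x : ℤ, |x| ≤ (Nsched k : ℤ) → ∀ τ : Tau S.d, tauNorm τ < T - k * t →
      S.g3φ R u uθ B p τ x = 0 := by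
  intro k
  induction k with
  | zero =>
    intro x hx τ hτ
    exact hzero0 x hx τ (by simpa using hτ)
  | succ k ih =>
    intro x hx τ hτ
    have key := S.g3_slab_kstep R u uθ B p i₀ hslab (N := Nsched k) (N' := Nsched (k + 1))
      (Tlo := T - k * t) ht hBw0 hBw ih hu huθ den₀ hden₀ hR hX hP K hK0 hK (hfinal k)
    refine key x hx τ ?_
    rw [Nat.succ_mul] at hτ
    omega

end TwoSetup

end Summit.ABC.StewartYu

end
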